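import Literature.AlgebraicGeometry.HodgeTheory.SkewVanishingLattice
import Mathlib.Tactic.Module
import Mathlib.Tactic.LinearCombination

/-!
# Route LinearSystemTorelli — crux `LocalTubeSpan` (stmt-HodgeConjecture-2490): transvection identities

Helper file (`--supports stmt-HodgeConjecture-2490`, line `Sketch` of the crux chain, cycle 8; the
lead's stub `stub_transvectionIdentities`): three pointwise identities of the transvection calculus
of an alternating form `B` on a `ℚ`-vector space `V` (`T_a x = x - B(x, a) a`, `skewTransvection`,
Schnell's symplectic transvection), inputs of the discharge of Janssen's theorems.

* `localTubeSpan_transvection_comp_of_orthogonal` — for `B(d, a) = 0` and `k : ℤ`,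
  `T_{kd+a} (T_{kd-a} v) = v - 2 B(v, a) a - 2k² B(v, d) d`, i.e.
  `T_{kd+a} ∘ T_{kd-a} = T_a² ∘ T_d^{2k²}` (manufacturing squares of transvections);
* `localTubeSpan_negOnPlane_comp_negOnPlane` — for a unimodular pair `B(u, w) = 1` and `n`
  orthogonal to `u` and `w`, the "`-1` of the plane `(u, w)`", `x ↦ x - 2 (B(x, w) u - B(x, u) w)`
  (the word `T_u² T_w² T_{u+w}²`), applied AFTER the "`-1` of the plane `(u, w + n)`" is the
  level-2 pair move `E_{u,n}² : v ↦ v + 2 (B(v, u) n + B(v, n) u)`;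
* `localTubeSpan_heisenberg_comp` — the Heisenberg composition law along a vector `n`: for `c, c'`
  orthogonal to `n` and `h_{c,k} x = x + B(x, c) n + B(x, n) c + k B(x, n) n`,
  `h_{c,k} ∘ h_{c',k'} = h_{c+c', k+k'+B(c',c)}`;
* `localTubeSpan_transvectionIdentities` — the registered conjunction of the three.

All three are pure bilinear algebra (expand, kill the cross pairings, `module`). No named facts;
no `sorry`.
-/

-- `Summit.HodgeConjecture.HodgeConjecture.Theorems` is the mandated namespace (single-conjunct summit:
-- Sub = Summit), which `linter.dupNamespace` flags on every declaration; the lakefile turns the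
-- linter off tree-wide (weak option), restated here so stand-alone elaboration is warning-free too.
set_option linter.dupNamespace false

noncomputable section

open Literature.AlgebraicGeometry.HodgeTheory

namespace Summit.HodgeConjecture.HodgeConjecture.Theorems

/-! ### Transvection identities of an alternating form -/

section TransvectionIdentities

variable {V : Type} [AddCommGroup V] [Module ℚ V]

/-- **Products of transvections along `kd ± a`.** For an alternating form `B`, `B(d, a) = 0` and an
integer `k`, `T_{kd+a} (T_{kd-a} v) = v - 2 B(v, a) a - 2k² B(v, d) d`; that is,
`T_{kd+a} ∘ T_{kd-a} = T_a² ∘ T_d^{2k²}` (the two factors `kd ± a` are `B`-orthogonal, so the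
cross term of the composite vanishes and the mixed terms `± k B(v, d) a ± k B(v, a) d` cancel).
[folklore] -/
theorem localTubeSpan_transvection_comp_of_orthogonal (B : LinearMap.BilinForm ℚ V) (hB : B.IsAlt)
    {d a : V} (hda : B d a = 0) (k : ℤ) (v : V) :
    skewTransvection B ((k : ℚ) • d + a) (skewTransvection B ((k : ℚ) • d - a) v) =
      v - (2 : ℚ) • (B v a • a) - (2 * (k : ℚ) ^ 2) • (B v d • d) := by
  have hdd : B d d = 0 := hB.self_eq_zero d
  have haa : B a a = 0 := hB.self_eq_zero a
  have had : B a d = 0 := by rw [← hB.neg_eq, hda, neg_zero]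
  simp only [skewTransvection_apply, map_add, map_sub, map_smul, smul_eq_mul, hdd, haa, hda, had]
  module

/-- **Two "`-1` of a plane" maps compose to a level-2 pair move.** For an alternating form `B`, a
unimodular pair `B(u, w) = 1` and a vector `n` orthogonal to `u` and `w`, applying the "`-1` of the
plane `(u, w)`", `x ↦ x - 2 (B(x, w) u - B(x, u) w)` (the action of the word `T_u² T_w² T_{u+w}²`),
to the image `v - 2 (B(v, w + n) u - B(v, u) (w + n))` of `v` under the "`-1` of the plane
`(u, w + n)`" gives `v + 2 (B(v, u) n + B(v, n) u)`, the square `E_{u,n}²` of the elementary pair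
move. [folklore] -/
theorem localTubeSpan_negOnPlane_comp_negOnPlane (B : LinearMap.BilinForm ℚ V) (hB : B.IsAlt)
    {u w n : V} (huw : B u w = 1) (hun : B u n = 0) (hwn : B w n = 0) (v : V) :
    (v - (2 : ℚ) • (B v (w + n) • u - B v u • (w + n))) -
        (2 : ℚ) • (B (v - (2 : ℚ) • (B v (w + n) • u - B v u • (w + n))) w • u -
          B (v - (2 : ℚ) • (B v (w + n) • u - B v u • (w + n))) u • w) =
      v + (2 : ℚ) • (B v u • n + B v n • u) := by
  have huu : B u u = 0 := hB.self_eq_zero u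
  have hww : B w w = 0 := hB.self_eq_zero w
  have hwu : B w u = -1 := by rw [← hB.neg_eq, huw]
  have hnu : B n u = 0 := by rw [← hB.neg_eq, hun, neg_zero]
  have hnw : B n w = 0 := by rw [← hB.neg_eq, hwn, neg_zero]
  simp only [map_add, map_sub, map_smul, LinearMap.add_apply, LinearMap.sub_apply,
    LinearMap.smul_apply, smul_eq_mul, huu, hww, huw, hwu, hnu, hnw]
  module

/-- **Heisenberg composition law along a vector `n`.** For an alternating form `B`, vectors `c, c'`
orthogonal to `n`, and scalars `k, k'`, the maps `h_{c,k} x = x + B(x, c) n + B(x, n) c + k B(x, n) n`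
compose as `h_{c,k} (h_{c',k'} v) = h_{c+c', k+k'+B(c',c)} v`
(`B(h_{c',k'} v, n) = B(v, n)` and `B(h_{c',k'} v, c) = B(v, c) + B(v, n) B(c', c)`, because
`B(n, n) = B(c', n) = B(n, c) = 0`). [folklore] -/
theorem localTubeSpan_heisenberg_comp (B : LinearMap.BilinForm ℚ V) (hB : B.IsAlt) {n c c' : V}
    (k k' : ℚ) (hcn : B c n = 0) (hc'n : B c' n = 0) (v : V) :
    (fun x => x + B x c • n + B x n • c + k • (B x n • n))
        ((fun x => x + B x c' • n + B x n • c' + k' • (B x n • n)) v) =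
      v + B v (c + c') • n + B v n • (c + c') + (k + k' + B c' c) • (B v n • n) := by
  have hnn : B n n = 0 := hB.self_eq_zero n
  have hnc : B n c = 0 := by rw [← hB.neg_eq, hcn, neg_zero]
  simp only [map_add, map_smul, LinearMap.add_apply, LinearMap.smul_apply, smul_eq_mul, hnn, hnc,
    hc'n]
  module

/-- **Transvection identities** (alternating `B`; the registered conjunction): (i) for `B(d, a) = 0`
and `k : ℤ`, `T_{kd+a} (T_{kd-a} v) = v - 2 B(v, a) a - 2k² B(v, d) d`
(`T_{kd+a} ∘ T_{kd-a} = T_a² ∘ T_d^{2k²}`); (ii) for `B(u, w) = 1` and `n` orthogonal to `u, w`,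
the "`-1` of the plane `(u, w)`" after the "`-1` of the plane `(u, w + n)`" is the level-2 pair
move `v ↦ v + 2 (B(v, u) n + B(v, n) u)`; (iii) for `c, c'` orthogonal to `n`, the Heisenberg
composition law `h_{c,k} ∘ h_{c',k'} = h_{c+c', k+k'+B(c',c)}` of the maps
`h_{c,k} x = x + B(x, c) n + B(x, n) c + k B(x, n) n`. [folklore] -/
theorem localTubeSpan_transvectionIdentities (B : LinearMap.BilinForm ℚ V) (hB : B.IsAlt) :
    (∀ (d a : V), B d a = 0 → ∀ (k : ℤ) (v : V),
      skewTransvection B ((k : ℚ) • d + a) (skewTransvection B ((k : ℚ) • d - a) v) =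
        v - (2 : ℚ) • (B v a • a) - (2 * (k : ℚ) ^ 2) • (B v d • d)) ∧
    (∀ (u w n : V), B u w = 1 → B u n = 0 → B w n = 0 → ∀ v : V,
      (v - (2 : ℚ) • (B v (w + n) • u - B v u • (w + n))) -
          (2 : ℚ) • (B (v - (2 : ℚ) • (B v (w + n) • u - B v u • (w + n))) w • u -
            B (v - (2 : ℚ) • (B v (w + n) • u - B v u • (w + n))) u • w) =
        v + (2 : ℚ) • (B v u • n + B v n • u)) ∧
    (∀ (n c c' : V) (k k' : ℚ), B c n = 0 → B c' n = 0 → ∀ v : V,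
      (fun x => x + B x c • n + B x n • c + k • (B x n • n))
          ((fun x => x + B x c' • n + B x n • c' + k' • (B x n • n)) v) =
        v + B v (c + c') • n + B v n • (c + c') + (k + k' + B c' c) • (B v n • n)) :=
  ⟨fun _ _ hda k v => localTubeSpan_transvection_comp_of_orthogonal B hB hda k v,
    fun _ _ _ huw hun hwn v => localTubeSpan_negOnPlane_comp_negOnPlane B hB huw hun hwn v,
    fun _ _ _ k k' hcn hc'n v => localTubeSpan_heisenberg_comp B hB k k' hcn hc'n v⟩

end TransvectionIdentities

end Summit.HodgeConjecture.HodgeConjecture.Theorems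

end
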